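import Literature.NumberTheory.Automorphic.GKModules
import Mathlib.Analysis.SpecialFunctions.Exponential
import Mathlib.Analysis.Normed.Operator.BanachSteinhaus
import Mathlib.Analysis.Calculus.MeanValue
import Mathlib.Analysis.Calculus.ContDiff.Operations
import Mathlib.Analysis.Calculus.FDeriv.Symmetric
import Mathlib.Analysis.Calculus.Deriv.Shift
import Mathlib.Analysis.Calculus.Deriv.Slope
import Mathlib.MeasureTheory.Integral.IntervalIntegral.FundThmCalculus
import Mathlib.Topology.UniformSpace.HeineCantor
import Mathlib.LinearAlgebra.Projection
import HarnessLib

/-!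
# Existence of the Harish-Chandra module: proof of `exists_isHarishChandraModuleOf`

This file discharges the named fact
`Literature.NumberTheory.Automorphic.exists_isHarishChandraModuleOf` (file `GKModules`):
for a strongly continuous representation `π` of a linear real group `G : RealMatrixGroup A N`
(`A` finite-dimensional) on a complex Banach space `H`, the space
`harishChandraSpace G π = smoothVectors G π ⊓ kFiniteVectors G π` carries a real Lie algebra action
`ρ : G.lie →ₗ⁅ℝ⁆ End_ℂ` with `ρ X v = d/dt π(exp tX) v |_{t=0}` (`exists_isHarishChandraModuleOf_holds`,
with the explicit action `harishChandraRepLie`).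

Recall that `smoothVectors` is defined by smoothness of `Y ↦ π(exp Y) v` on the normed space
`𝔤 = G.lie.toSubmodule` (no Lie-group structure on `G.carrier` is available, and `G.lie` need not be
the full Lie algebra of `G.carrier`). The classical proofs (Harish-Chandra 1953, §7 and §9; Wallach,
§1.6.2 and Lemma 3.3.3) work with smooth functions on the group; here we give a direct proof on `𝔤`,
valid for any monoid homomorphism `σ : G →* (E →L[ℝ] E)` into a real Banach space with continuous
orbit maps (namespace `ExpOrbit`):

* `ExpOrbit.exists_norm_le_of_isCompact`, `ExpOrbit.continuous_apply₂`: local boundedness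
  (Banach–Steinhaus) and joint continuity of `(g, x) ↦ σ g x`.
* `ExpOrbit.hasDerivAt_orbit_line` (**Duhamel's formula**): if `F_w : Y ↦ σ(exp Y) w` is
  differentiable at `0` with differential `δ`, then `F_w` has at every `Y` the directional derivative
  `σ(exp Y) δ (L(Y) W)` in direction `W`, where `L(Y) = ∫₀¹ Ad(exp ((r-1)Y)) dr`
  (`RealMatrixGroup.dexpInt`); the proof differentiates
  `s ↦ σ(exp (s(Y + hW))) σ(exp ((1-s)Y)) w` and uses the mean value inequality.
* Applied to the left regular representation on `Matrix N N A` this gives the differential of the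
  matrix exponential `D exp(Y) W = exp Y · L(Y) W` (`ExpOrbit.fderiv_exp_coe_apply`), whence
  smoothness of `L` (`ExpOrbit.contDiff_dexpInt`).
* `ExpOrbit.hasFDerivAt_orbit`: differentiability of `F_w` at `0` propagates to `C¹` on `𝔤` with
  `DF_w(Y) = σ(exp Y) ∘ δ ∘ L(Y)`; near `0` this inverts to
  `F_{δ X}(Y) = DF_w(Y)(L(Y)⁻¹ X)` (`ExpOrbit.orbit_fderiv_eventuallyEq`), and an induction on `k`
  (`ExpOrbit.contDiff_orbit_induction`) shows that `C^k` near `0` implies `C^k` everywhere and that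
  smooth vectors are stable under `X ↦ δ X` (`ExpOrbit.contDiff_orbit_fderiv`).
* `ExpOrbit.fderiv_orbit_bracket`: the bracket relation `δ_{δ_w X'} X − δ_{δ_w X} X' = δ_w ⁅X, X'⁆`,
  from the symmetry of the second derivatives of `F_w` and of `exp` at `0`.
* Finally (`dπ_mem_harishChandraSpace`) `K`-finiteness is preserved since
  `π(k) dπ(X) w = dπ(Ad(k) X) π(k) w` and `dim 𝔤 < ∞`.

## References

* Harish-Chandra, *Representations of a semisimple Lie group on a Banach space. I*,
  Trans. Amer. Math. Soc. 75 (1953), 185–243, §7 (p. 209) and §9 (p. 225).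
  doi:10.1090/S0002-9947-1953-0056610-2.
* N. R. Wallach, *Real Reductive Groups I*, Academic Press 1988, §1.6.1–1.6.2, Lemma 3.3.3, §3.3.4.
* A. W. Knapp, *Lie Groups Beyond an Introduction*, 2nd ed., Birkhäuser 2002, I.§10 (the
  differential of `exp`, Duhamel's formula).
-/

-- Mathlib idiom (Mathlib/Algebra/Lie/OfAssociative.lean)
attribute [local instance 100] LieRing.ofAssociativeRing

-- The scoped `L^∞`-operator normed structure on `Matrix N N A` agrees with the product uniformity /
-- topology only up to non-reducible unfolding (cf. `Matrix.exp_add_of_commute` in Mathlib).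
set_option backward.isDefEq.respectTransparency false

open scoped MatrixGroups Matrix ContDiff Topology
open NormedSpace Filter

noncomputable section

namespace Literature.NumberTheory.Automorphic

open scoped Matrix.Norms.Operator

variable {A : Type*} [NormedCommRing A] [NormedAlgebra ℝ A] [NormedAlgebra ℚ A] [CompleteSpace A]
  [StarRing A] {N : Type*} [Fintype N] [DecidableEq N] (G : RealMatrixGroup A N)

namespace RealMatrixGroup

/-! ## The exponential on the normed Lie algebra `𝔤 = G.lie.toSubmodule` -/

/-- The exponential `𝔤 → G` on the normed space `𝔤 = G.lie.toSubmodule` (the map whose pull-back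
defines `smoothVectors`). Knapp, I.§10, Prop. 1.87. [folklore] -/
abbrev expS (Y : G.lie.toSubmodule) : G.carrier := G.expMem ⟨Y, Y.2⟩

/-- `expS Y = exp Y` as matrices. [folklore] -/
@[simp]
theorem coe_coe_expS (Y : G.lie.toSubmodule) :
    ((G.expS Y : GL N A) : Matrix N N A) = exp (Y : Matrix N N A) := rfl

/-- `↑(expS Y)⁻¹ = exp (-Y)` as matrices. [folklore] -/
@[simp]
theorem coe_inv_coe_expS (Y : G.lie.toSubmodule) :
    (((G.expS Y : GL N A)⁻¹ : GL N A) : Matrix N N A) = exp (-(Y : Matrix N N A)) := by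
  rw [coe_expMem, ← expGL_neg, coe_expGL]

/-- `exp 0 = 1`. [folklore] -/
@[simp]
theorem expS_zero : G.expS 0 = 1 := by
  ext : 1
  simp [expS, expMem]

/-- `exp ((s + t) Y) = exp (s Y) exp (t Y)`. [folklore] -/
theorem expS_add_smul (s t : ℝ) (Y : G.lie.toSubmodule) :
    G.expS ((s + t) • Y) = G.expS (s • Y) * G.expS (t • Y) := by
  ext : 1
  exact expGL_add_smul s t (Y : Matrix N N A)

/-- `exp (Y + Z) = exp Y * exp Z` for proportional `Y`, `Z`: `exp (sY) exp (tY)` version with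
`s Y + t Y`. [folklore] -/
theorem expS_smul_add_smul (s t : ℝ) (Y : G.lie.toSubmodule) :
    G.expS (s • Y + t • Y) = G.expS (s • Y) * G.expS (t • Y) := by
  rw [← add_smul, expS_add_smul]

/-- `exp (-Y) = (exp Y)⁻¹`. [folklore] -/
theorem expS_neg (Y : G.lie.toSubmodule) : G.expS (-Y) = (G.expS Y)⁻¹ := by
  ext : 1
  exact expGL_neg (Y : Matrix N N A)

/-- `exp (s Y)` and `exp (t Y)` commute. [folklore] -/
theorem expS_smul_comm (s t : ℝ) (Y : G.lie.toSubmodule) :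
    G.expS (s • Y) * G.expS (t • Y) = G.expS (t • Y) * G.expS (s • Y) := by
  rw [← expS_add_smul, add_comm, expS_add_smul]

/-- The exponential `𝔤 → G` is continuous. [folklore] -/
theorem continuous_expS : Continuous G.expS := by
  refine Continuous.subtype_mk ?_ _
  refine Units.continuous_iff.2 ⟨?_, ?_⟩
  · exact exp_continuous.comp continuous_subtype_val
  · have : (fun Y : G.lie.toSubmodule ↦ ((expGL (Y : Matrix N N A))⁻¹ : GL N A).val) =
        fun Y : G.lie.toSubmodule ↦ exp (-(Y : Matrix N N A)) := by
      funext Y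
      rw [← expGL_neg, coe_expGL]
    change Continuous fun Y : G.lie.toSubmodule ↦ ((expGL (Y : Matrix N N A))⁻¹ : GL N A).val
    rw [this]
    exact exp_continuous.comp continuous_subtype_val.neg

/-- `Y ↦ exp Y : 𝔤 → Matrix N N A` is smooth. [folklore] -/
theorem contDiff_exp_coe : ContDiff ℝ ∞ fun Y : G.lie.toSubmodule ↦ exp (Y : Matrix N N A) :=
  (contDiff_iff_contDiffAt.2 fun x ↦ (exp_analytic x).contDiffAt).comp
    G.lie.toSubmodule.subtypeL.contDiff

/-- `Y ↦ exp Y : 𝔤 → Matrix N N A` has derivative the inclusion at `0`. [folklore] -/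
theorem hasFDerivAt_exp_coe_zero :
    HasFDerivAt (fun Y : G.lie.toSubmodule ↦ exp (Y : Matrix N N A)) G.lie.toSubmodule.subtypeL 0 := by
  have h : HasFDerivAt (exp : Matrix N N A → Matrix N N A) (1 : Matrix N N A →L[ℝ] Matrix N N A)
      (G.lie.toSubmodule.subtypeL 0) := by
    rw [map_zero]; exact hasFDerivAt_exp_zero
  have h2 := h.comp 0 G.lie.toSubmodule.subtypeL.hasFDerivAt
  rw [ContinuousLinearMap.one_def, ContinuousLinearMap.id_comp] at h2
  exact h2

/-! ## The adjoint action along one-parameter groups -/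

/-- `Ad (exp Z) W = exp Z * W * exp (-Z)` as matrices. [folklore] -/
theorem coe_AdCLM_expS (Z W : G.lie.toSubmodule) :
    (G.AdCLM (G.expS Z) W : Matrix N N A) = exp (Z : Matrix N N A) * W * exp (-(Z : Matrix N N A)) := by
  rw [AdCLM_apply_coe, coe_coe_expS, coe_inv_coe_expS]

/-- `Ad (exp (c Y)) Y = Y`. [folklore] -/
theorem AdCLM_expS_smul_self (c : ℝ) (Y : G.lie.toSubmodule) :
    G.AdCLM (G.expS (c • Y)) Y = Y := by
  ext : 1
  rw [coe_AdCLM_expS, Submodule.coe_smul,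
    ((Commute.refl (Y : Matrix N N A)).smul_left c).exp_left.eq, mul_assoc,
    ← exp_add_of_commute (Commute.refl (c • (Y : Matrix N N A))).neg_right, add_neg_cancel,
    exp_zero, mul_one]

/-- `Ad (g h) = Ad g ∘ Ad h`. [folklore] -/
theorem AdCLM_mul (g h : G.carrier) : G.AdCLM (g * h) = (G.AdCLM g).comp (G.AdCLM h) := by
  ext X : 2
  simp only [AdCLM_apply_coe, Subgroup.coe_mul, mul_inv_rev, Units.val_mul,
    ContinuousLinearMap.coe_comp, Function.comp_apply]
  simp [mul_assoc]

/-- `Ad 1 = id`. [folklore] -/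
@[simp]
theorem AdCLM_one : G.AdCLM 1 = ContinuousLinearMap.id ℝ _ := by
  ext X : 2
  simp [AdCLM_apply_coe]

/-- `t ↦ Ad (exp (t X)) W` has derivative `⁅X, W⁆` at `t = 0` (as a matrix-valued map). [folklore] -/
theorem hasDerivAt_coe_AdCLM_expS_smul (X W : G.lie.toSubmodule) :
    HasDerivAt (fun t : ℝ ↦ (G.AdCLM (G.expS (t • X)) W : Matrix N N A))
      ((X : Matrix N N A) * W - W * X) 0 := by
  have h1 : HasDerivAt (fun t : ℝ ↦ exp (t • (X : Matrix N N A))) (X : Matrix N N A) 0 := by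
    simpa using hasDerivAt_exp_smul_const (𝕂 := ℝ) (X : Matrix N N A) 0
  have h2 : HasDerivAt (fun t : ℝ ↦ exp (-(t • (X : Matrix N N A)))) (-(X : Matrix N N A)) 0 := by
    have := hasDerivAt_exp_smul_const (𝕂 := ℝ) (-(X : Matrix N N A)) 0
    simp only [zero_smul, smul_neg, neg_zero, exp_zero, one_mul] at this
    exact this
  have h3 := (h1.mul_const (W : Matrix N N A)).mul h2
  simp only [zero_smul, exp_zero, one_mul, neg_zero, mul_one, mul_neg] at h3
  have h4 : (fun t : ℝ ↦ (G.AdCLM (G.expS (t • X)) W : Matrix N N A)) =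
      fun t : ℝ ↦ exp (t • (X : Matrix N N A)) * W * exp (-(t • (X : Matrix N N A))) := by
    funext t
    rw [coe_AdCLM_expS, Submodule.coe_smul]
  rw [h4, sub_eq_add_neg]
  exact h3

/-- The commutator `X W - W X` of `X W ∈ 𝔤`, as an element of the normed space `𝔤`
(this is the bracket of `G.lie`, cf. `coe_brS`). [folklore] -/
def brS (X W : G.lie.toSubmodule) : G.lie.toSubmodule :=
  ⟨(X : Matrix N N A) * W - W * X, G.lie.lie_mem X.2 W.2⟩

/-- `brS X W = X W - W X`. [folklore] -/
@[simp]
theorem coe_brS (X W : G.lie.toSubmodule) :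
    (G.brS X W : Matrix N N A) = (X : Matrix N N A) * W - W * X := rfl

section FiniteDimensional

variable [FiniteDimensional ℝ A]

/-- `G` is locally compact (a closed subgroup of `GL N A`, `A` finite-dimensional). [folklore] -/
instance locallyCompactSpace_carrier : LocallyCompactSpace G.carrier :=
  haveI : LocallyCompactSpace (GL N A) := Units.isOpenEmbedding_val.locallyCompactSpace
  G.isClosed.isClosedEmbedding_subtypeVal.locallyCompactSpace

/-- The inclusion `𝔤 → Matrix N N A` has a continuous linear left inverse. [folklore] -/
theorem exists_leftInverse_subtypeL :
    ∃ P : Matrix N N A →L[ℝ] G.lie.toSubmodule, ∀ X : G.lie.toSubmodule, P X = X := by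
  obtain ⟨q, hq⟩ := G.lie.toSubmodule.exists_isCompl
  exact ⟨LinearMap.toContinuousLinearMap (Submodule.projectionOnto _ q hq),
    fun X ↦ Submodule.projectionOnto_apply_left hq X⟩

/-- A continuous linear left inverse `Matrix N N A → 𝔤` of the inclusion. [folklore] -/
def projL : Matrix N N A →L[ℝ] G.lie.toSubmodule :=
  G.exists_leftInverse_subtypeL.choose

/-- `projL` is a left inverse of the inclusion. [folklore] -/
@[simp]
theorem projL_apply_coe (X : G.lie.toSubmodule) : G.projL X = X :=
  G.exists_leftInverse_subtypeL.choose_spec X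

/-- `t ↦ Ad (exp (t X)) W` has derivative `⁅X, W⁆` at `t = 0`. Knapp, I.§10, Prop. 1.91 context.
[folklore] -/
theorem hasDerivAt_AdCLM_expS_smul (X W : G.lie.toSubmodule) :
    HasDerivAt (fun t : ℝ ↦ G.AdCLM (G.expS (t • X)) W) (G.brS X W) 0 := by
  have h := G.projL.hasFDerivAt.comp_hasDerivAt 0 (G.hasDerivAt_coe_AdCLM_expS_smul X W)
  have h1 : (G.projL ∘ fun t : ℝ ↦ (G.AdCLM (G.expS (t • X)) W : Matrix N N A)) =
      fun t : ℝ ↦ G.AdCLM (G.expS (t • X)) W := by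
    funext t
    exact G.projL_apply_coe _
  have h2 : G.projL ((X : Matrix N N A) * W - W * X) = G.brS X W := G.projL_apply_coe (G.brS X W)
  rw [h1, h2] at h
  exact h

/-- `s ↦ Ad (exp ((s - 1) Y)) W` is continuous. [folklore] -/
theorem continuous_AdCLM_expS_sub_smul (Y W : G.lie.toSubmodule) :
    Continuous fun s : ℝ ↦ G.AdCLM (G.expS ((s - 1) • Y)) W := by
  have h1 : (G.projL ∘ fun s : ℝ ↦ (G.AdCLM (G.expS ((s - 1) • Y)) W : Matrix N N A)) =
      fun s : ℝ ↦ G.AdCLM (G.expS ((s - 1) • Y)) W := by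
    funext t
    exact G.projL_apply_coe _
  rw [← h1]
  refine G.projL.continuous.comp ?_
  simp only [coe_AdCLM_expS, Submodule.coe_smul]
  exact ((exp_continuous.comp ((continuous_id.sub continuous_const).smul continuous_const)).mul
    continuous_const).mul
    (exp_continuous.comp ((continuous_id.sub continuous_const).smul continuous_const).neg)

/-- The integrand `r ↦ Ad (exp ((r - 1) Y)) W` is interval integrable. [folklore] -/
theorem intervalIntegrable_AdCLM (Y W : G.lie.toSubmodule) (a b : ℝ) :
    IntervalIntegrable (fun r : ℝ ↦ G.AdCLM (G.expS ((r - 1) • Y)) W) MeasureTheory.volume a b :=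
  (G.continuous_AdCLM_expS_sub_smul Y W).intervalIntegrable a b

/-- The operator `L(Y) W := ∫₀¹ Ad (exp ((r - 1) Y)) W dr = ((1 - e^{-ad Y}) / ad Y) W` on `𝔤`, the
(right-trivialised) differential of `exp` at `Y`: `D exp (Y) W = exp Y · L(Y) W`
(`hasFDerivAt_exp_coe`). Knapp, I.§10, proof of Prop. 1.90 context (Duhamel's formula). [folklore] -/
def dexpInt (Y : G.lie.toSubmodule) : G.lie.toSubmodule →L[ℝ] G.lie.toSubmodule :=
  LinearMap.toContinuousLinearMap
    { toFun := fun W ↦ ∫ r in (0 : ℝ)..1, G.AdCLM (G.expS ((r - 1) • Y)) W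
      map_add' := fun W₁ W₂ ↦ by
        simp only [map_add]
        exact intervalIntegral.integral_add (G.intervalIntegrable_AdCLM Y W₁ 0 1)
          (G.intervalIntegrable_AdCLM Y W₂ 0 1)
      map_smul' := fun c W ↦ by
        simp only [map_smul, RingHom.id_apply]
        exact intervalIntegral.integral_smul c _ }

/-- Unfolding `dexpInt`. [folklore] -/
theorem dexpInt_apply (Y W : G.lie.toSubmodule) :
    G.dexpInt Y W = ∫ r in (0 : ℝ)..1, G.AdCLM (G.expS ((r - 1) • Y)) W := rfl

/-- `L(0) = 1`. [folklore] -/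
@[simp]
theorem dexpInt_zero : G.dexpInt 0 = 1 := by
  ext W : 1
  simp [dexpInt_apply]

/-- `d/ds ∫₀ˢ Ad (exp ((r - 1) Y)) W dr = Ad (exp ((s - 1) Y)) W`. [folklore] -/
theorem hasDerivAt_integral_AdCLM (Y W : G.lie.toSubmodule) (s : ℝ) :
    HasDerivAt (fun u : ℝ ↦ ∫ r in (0 : ℝ)..u, G.AdCLM (G.expS ((r - 1) • Y)) W)
      (G.AdCLM (G.expS ((s - 1) • Y)) W) s :=
  intervalIntegral.integral_hasDerivAt_right (G.intervalIntegrable_AdCLM Y W 0 s)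
    ((G.continuous_AdCLM_expS_sub_smul Y W).stronglyMeasurableAtFilter _ _)
    (G.continuous_AdCLM_expS_sub_smul Y W).continuousAt

end FiniteDimensional

end RealMatrixGroup

/-! ## Orbit maps of a representation of `G` on a real Banach space, pulled back by `exp` -/

namespace ExpOrbit

variable {E : Type*} [NormedAddCommGroup E] [NormedSpace ℝ E] (σ : G.carrier →* (E →L[ℝ] E))

/-- The orbit map `Y ↦ σ (exp Y) w` of `w` pulled back to the normed Lie algebra `𝔤`; for
`σ = π` this is the map whose smoothness defines `smoothVectors`. Wallach, §1.6.1. [folklore] -/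
def orbit (w : E) : G.lie.toSubmodule → E := fun Y ↦ σ (G.expS Y) w

/-- Unfolding `orbit`. [folklore] -/
theorem orbit_apply (w : E) (Y : G.lie.toSubmodule) : orbit G σ w Y = σ (G.expS Y) w := rfl

/-- `orbit w 0 = w`. [folklore] -/
@[simp]
theorem orbit_zero (w : E) : orbit G σ w 0 = w := by
  simp [orbit_apply]

/-- The one-parameter group law along a line: `σ (exp ((s + t) Y)) w = σ (exp (s Y)) (σ (exp (t Y)) w)`.
[folklore] -/
theorem orbit_add_smul (w : E) (s t : ℝ) (Y : G.lie.toSubmodule) :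
    orbit G σ w ((s + t) • Y) = σ (G.expS (s • Y)) (orbit G σ w (t • Y)) := by
  rw [orbit_apply, orbit_apply, G.expS_add_smul, map_mul, mul_apply_eq_comp]

/-- `orbit` is additive in the vector. [folklore] -/
theorem orbit_add (v w : E) : orbit G σ (v + w) = orbit G σ v + orbit G σ w := by
  funext Y; simp [orbit_apply]

/-- `orbit` is homogeneous in the vector. [folklore] -/
theorem orbit_smul (c : ℝ) (w : E) : orbit G σ (c • w) = c • orbit G σ w := by
  funext Y; simp [orbit_apply]

/-- Equivariance: `σ (exp Y) (σ g w) = σ g (σ (exp (Ad g⁻¹ Y)) w)`. Wallach, §1.6.2 (Lemma).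
[folklore] -/
theorem orbit_conj (g : G.carrier) (w : E) :
    orbit G σ (σ g w) = fun Y ↦ σ g (orbit G σ w (G.AdCLM g⁻¹ Y)) := by
  funext Y
  simp only [orbit_apply]
  have hY : G.expS (G.AdCLM g⁻¹ Y) = g⁻¹ * G.expS Y * g := by
    rw [show G.expS (G.AdCLM g⁻¹ Y) = G.expMem (G.Ad g⁻¹ ⟨Y, Y.2⟩) from rfl, G.expMem_Ad, inv_inv]
  rw [hY, ← mul_apply_eq_comp, ← map_mul, ← mul_apply_eq_comp, ← map_mul,
    ← mul_assoc, ← mul_assoc, mul_inv_cancel, one_mul]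

/-- Orbit maps of a strongly continuous representation are continuous. [folklore] -/
theorem continuous_orbit (hσ : ∀ v, Continuous fun g : G.carrier ↦ σ g v) (w : E) :
    Continuous (orbit G σ w) :=
  (hσ w).comp G.continuous_expS

/-- Equivariance of the differential at `0`: if `Y ↦ σ (exp Y) w` has derivative `δ` at `0` then
`Y ↦ σ (exp Y) (σ g w)` has derivative `σ g ∘ δ ∘ Ad g⁻¹` at `0`. Wallach, §1.6.2. [folklore] -/
theorem hasFDerivAt_orbit_conj {w : E} {δ : G.lie.toSubmodule →L[ℝ] E}
    (hδ : HasFDerivAt (orbit G σ w) δ 0) (g : G.carrier) :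
    HasFDerivAt (orbit G σ (σ g w)) ((σ g).comp (δ.comp (G.AdCLM g⁻¹))) 0 := by
  rw [orbit_conj]
  have h0 : HasFDerivAt (orbit G σ w) δ (G.AdCLM g⁻¹ 0) := by rwa [map_zero]
  exact (σ g).hasFDerivAt.comp 0 (h0.comp 0 (G.AdCLM g⁻¹).hasFDerivAt)

/-- Derivative along a one-parameter group at any time: if `Y ↦ σ (exp Y) w` has derivative `δ`
at `0`, then `t ↦ σ (exp (t Z)) w` has derivative `σ (exp (s Z)) (δ Z)` at `t = s`.
Wallach, §1.6.1. [folklore] -/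
theorem hasDerivAt_orbit_smul {w : E} {δ : G.lie.toSubmodule →L[ℝ] E}
    (hδ : HasFDerivAt (orbit G σ w) δ 0) (Z : G.lie.toSubmodule) (s : ℝ) :
    HasDerivAt (fun t : ℝ ↦ orbit G σ w (t • Z)) (σ (G.expS (s • Z)) (δ Z)) s := by
  have h1 : HasDerivAt (fun t : ℝ ↦ (t - s) • Z) Z s := by
    simpa using ((hasDerivAt_id s).sub_const s).smul_const Z
  have h2 : HasDerivAt (fun t : ℝ ↦ orbit G σ w ((t - s) • Z)) (δ Z) s :=
    hδ.comp_hasDerivAt_of_eq s h1 (by simp)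
  have h3 := (σ (G.expS (s • Z))).hasFDerivAt.comp_hasDerivAt s h2
  refine h3.congr_of_eventuallyEq (Eventually.of_forall fun t ↦ ?_)
  show orbit G σ w (t • Z) = σ (G.expS (s • Z)) (orbit G σ w ((t - s) • Z))
  rw [← orbit_add_smul, add_sub_cancel]

section Banach

variable [CompleteSpace E]

/-- Local boundedness (Banach–Steinhaus): a strongly continuous representation is bounded in
operator norm on compact sets. Wallach, Lemma 1.1.1 context. [folklore] -/
theorem exists_norm_le_of_isCompact (hσ : ∀ v, Continuous fun g : G.carrier ↦ σ g v)
    {K : Set G.carrier} (hK : IsCompact K) : ∃ C, ∀ g ∈ K, ‖σ g‖ ≤ C := by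
  have h : ∀ x : E, ∃ C, ∀ g : K, ‖σ (g : G.carrier) x‖ ≤ C := fun x ↦ by
    obtain ⟨C, hC⟩ := (hK.image (hσ x)).isBounded.exists_norm_le
    exact ⟨C, fun g ↦ hC _ ⟨g, g.2, rfl⟩⟩
  obtain ⟨C, hC⟩ := banach_steinhaus (g := fun g : K ↦ σ (g : G.carrier)) h
  exact ⟨C, fun g hg ↦ hC ⟨g, hg⟩⟩

/-! ## The differential of `exp` and smoothness of `dexpInt` (via the left regular representation) -/

/-- The left regular representation `g ↦ (X ↦ g X)` of `G` on `Matrix N N A`. [folklore] -/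
def leftMulRep : G.carrier →* (Matrix N N A →L[ℝ] Matrix N N A) where
  toFun g := ContinuousLinearMap.mul ℝ (Matrix N N A) ((g : GL N A) : Matrix N N A)
  map_one' := by ext X; simp
  map_mul' g h := by ext X; simp [mul_assoc]

/-- `leftMulRep g X = g X`. [folklore] -/
@[simp]
theorem leftMulRep_apply (g : G.carrier) (X : Matrix N N A) :
    leftMulRep G g X = ((g : GL N A) : Matrix N N A) * X := rfl

/-- The left regular representation is strongly continuous. [folklore] -/
theorem continuous_leftMulRep_apply (X : Matrix N N A) :
    Continuous fun g : G.carrier ↦ leftMulRep G g X := by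
  simp only [leftMulRep_apply]
  exact (Units.continuous_val.comp continuous_subtype_val).mul continuous_const

/-- The orbit map of `1` under the left regular representation is `Y ↦ exp Y`. [folklore] -/
theorem orbit_leftMulRep_one :
    orbit G (leftMulRep G) 1 = fun Y : G.lie.toSubmodule ↦ exp (Y : Matrix N N A) := by
  funext Y
  simp [orbit_apply]

variable [FiniteDimensional ℝ A]

/-- Joint continuity of `(g, x) ↦ σ g x` for a strongly continuous representation of the locally
compact group `G` on a Banach space. [folklore] -/
theorem continuous_apply₂ (hσ : ∀ v, Continuous fun g : G.carrier ↦ σ g v) :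
    Continuous fun p : G.carrier × E ↦ σ p.1 p.2 := by
  refine continuous_iff_continuousAt.2 fun p₀ ↦ ?_
  obtain ⟨K, hK, hKp⟩ := exists_compact_mem_nhds p₀.1
  obtain ⟨C, hC⟩ := exists_norm_le_of_isCompact G σ hσ hK
  rw [ContinuousAt, tendsto_iff_norm_sub_tendsto_zero]
  have hev : ∀ᶠ p : G.carrier × E in 𝓝 p₀,
      ‖σ p.1 p.2 - σ p₀.1 p₀.2‖ ≤ C * ‖p.2 - p₀.2‖ + ‖σ p.1 p₀.2 - σ p₀.1 p₀.2‖ := by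
    filter_upwards [(continuous_fst.tendsto p₀).eventually_mem hKp] with p hp
    have : σ p.1 p.2 - σ p₀.1 p₀.2 = σ p.1 (p.2 - p₀.2) + (σ p.1 p₀.2 - σ p₀.1 p₀.2) := by
      rw [map_sub]; abel
    rw [this]
    refine (norm_add_le _ _).trans (add_le_add ?_ le_rfl)
    exact (ContinuousLinearMap.le_opNorm _ _).trans
      (mul_le_mul_of_nonneg_right (hC _ hp) (norm_nonneg _))
  refine squeeze_zero' (Eventually.of_forall fun p ↦ norm_nonneg _) hev ?_
  have hc : Continuous fun p : G.carrier × E ↦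
      C * ‖p.2 - p₀.2‖ + ‖σ p.1 p₀.2 - σ p₀.1 p₀.2‖ :=
    (continuous_const.mul (continuous_snd.sub continuous_const).norm).add
      (((hσ p₀.2).comp continuous_fst).sub continuous_const).norm
  simpa using hc.tendsto p₀

/-- Product rule for a one-parameter group applied to a differentiable curve of vectors whose value
is differentiable along `exp`: `d/ds σ(exp (s Z)) ψ(s) = σ(exp (s Z)) ψ'(s) + σ(exp (s Z)) δ_{ψ(s)} Z`.
Wallach, §1.6.1 context. [folklore] -/
theorem hasDerivAt_expS_smul_apply (hσ : ∀ v, Continuous fun g : G.carrier ↦ σ g v)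
    {Z : G.lie.toSubmodule} {ψ : ℝ → E} {ψ' : E} {s₀ : ℝ} (hψ : HasDerivAt ψ ψ' s₀)
    {δ : G.lie.toSubmodule →L[ℝ] E} (hδ : HasFDerivAt (orbit G σ (ψ s₀)) δ 0) :
    HasDerivAt (fun s : ℝ ↦ σ (G.expS (s • Z)) (ψ s))
      (σ (G.expS (s₀ • Z)) ψ' + σ (G.expS (s₀ • Z)) (δ Z)) s₀ := by
  rw [hasDerivAt_iff_tendsto_slope]
  have hT : Continuous fun s : ℝ ↦ G.expS (s • Z) :=
    G.continuous_expS.comp (continuous_id.smul continuous_const)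
  have key : slope (fun s : ℝ ↦ σ (G.expS (s • Z)) (ψ s)) s₀ =
      fun s ↦ σ (G.expS (s • Z)) (slope ψ s₀ s) +
        slope (fun s : ℝ ↦ σ (G.expS (s • Z)) (ψ s₀)) s₀ s := by
    funext s
    simp only [slope_def_module, map_smul, map_sub, smul_sub]
    abel
  rw [key]
  refine Tendsto.add ?_ ?_
  · have hc := ((continuous_apply₂ G σ hσ).tendsto (G.expS (s₀ • Z), ψ')).comp
      ((((hT.tendsto s₀).mono_left nhdsWithin_le_nhds).prodMk_nhds
        (hasDerivAt_iff_tendsto_slope.1 hψ)))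
    exact hc
  · exact hasDerivAt_iff_tendsto_slope.1 (hasDerivAt_orbit_smul G σ hδ Z s₀)

/-- **Duhamel's formula for vectors differentiable along `exp`.** If `Y ↦ σ (exp Y) w` has
derivative `δ` at `0`, then at every `Y ∈ 𝔤` it has the directional derivative
`σ (exp Y) δ (L(Y) W)` in the direction `W`, where `L(Y) = ∫₀¹ Ad (exp ((r - 1) Y)) dr`
(`dexpInt`). The proof differentiates `s ↦ σ(exp (s (Y + h W))) σ(exp ((1 - s) Y)) w` and uses the
mean value inequality. Knapp, I.§10 (Duhamel) and Wallach, §1.6.1–1.6.2 context. [folklore] -/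
theorem hasDerivAt_orbit_line (hσ : ∀ v, Continuous fun g : G.carrier ↦ σ g v) {w : E}
    {δ : G.lie.toSubmodule →L[ℝ] E} (hδ : HasFDerivAt (orbit G σ w) δ 0)
    (Y W : G.lie.toSubmodule) :
    HasDerivAt (fun t : ℝ ↦ orbit G σ w (Y + t • W)) (σ (G.expS Y) (δ (G.dexpInt Y W))) 0 := by
  -- the integrands
  obtain ⟨κ, hκ⟩ : ∃ κ : ℝ → ℝ → E, κ = fun h s ↦ σ (G.expS (s • (Y + h • W)))
      (σ (G.expS ((1 - s) • Y)) (δ (G.AdCLM (G.expS ((s - 1) • Y)) W))) := ⟨_, rfl⟩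
  obtain ⟨κ₀, hκ₀⟩ : ∃ κ₀ : ℝ → E,
      κ₀ = fun s ↦ σ (G.expS Y) (δ (G.AdCLM (G.expS ((s - 1) • Y)) W)) := ⟨_, rfl⟩
  have hκ0 : ∀ s, κ 0 s = κ₀ s := fun s ↦ by
    simp only [hκ, hκ₀, zero_smul, add_zero]
    rw [← mul_apply_eq_comp, ← map_mul, ← G.expS_smul_add_smul, ← add_smul, add_sub_cancel,
      one_smul]
  -- (i) joint continuity of `κ`
  have hinner : Continuous fun p : ℝ × ℝ ↦ δ (G.AdCLM (G.expS ((p.2 - 1) • Y)) W) :=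
    δ.continuous.comp ((G.continuous_AdCLM_expS_sub_smul Y W).comp continuous_snd)
  have hmid : Continuous fun p : ℝ × ℝ ↦
      σ (G.expS ((1 - p.2) • Y)) (δ (G.AdCLM (G.expS ((p.2 - 1) • Y)) W)) :=
    (continuous_apply₂ G σ hσ).comp
      ((G.continuous_expS.comp ((continuous_const.sub continuous_snd).smul
        continuous_const)).prodMk hinner)
  have κcont : Continuous (Function.uncurry κ) := by
    rw [hκ]
    exact (continuous_apply₂ G σ hσ).comp ((G.continuous_expS.comp
      (continuous_snd.smul (continuous_const.add (continuous_fst.smul continuous_const)))).prodMk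
        hmid)
  -- (ii) uniform convergence `κ h → κ 0` on `[0, 1]`
  have hunif : TendstoUniformly (fun (h : ℝ) (s : Set.Icc (0 : ℝ) 1) ↦ κ h s)
      (fun s ↦ κ 0 s) (𝓝 0) :=
    Continuous.tendstoUniformly (fun (h : ℝ) (s : Set.Icc (0 : ℝ) 1) ↦ κ h s)
      (κcont.comp (continuous_fst.prodMk (continuous_subtype_val.comp continuous_snd))) 0
  -- (iii) the derivative of `φ_h - Θ_h`
  obtain ⟨f, hf⟩ : ∃ f : ℝ → ℝ → E, f = fun h s ↦
      σ (G.expS (s • (Y + h • W))) (orbit G σ w ((1 - s) • Y)) -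
        h • σ (G.expS Y) (δ (∫ r in (0 : ℝ)..s, G.AdCLM (G.expS ((r - 1) • Y)) W)) := ⟨_, rfl⟩
  have hderiv : ∀ h s : ℝ, HasDerivAt (f h) (h • (κ h s - κ₀ s)) s := fun h s ↦ by
    have hψ : HasDerivAt (fun s : ℝ ↦ orbit G σ w ((1 - s) • Y))
        (-(σ (G.expS ((1 - s) • Y)) (δ Y))) s :=
      HasDerivAt.comp_const_sub 1 s (hasDerivAt_orbit_smul G σ hδ Y (1 - s))
    have hδ' : HasFDerivAt (orbit G σ (orbit G σ w ((1 - s) • Y)))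
        ((σ (G.expS ((1 - s) • Y))).comp (δ.comp (G.AdCLM (G.expS ((1 - s) • Y))⁻¹))) 0 :=
      hasFDerivAt_orbit_conj G σ hδ _
    have hφ := hasDerivAt_expS_smul_apply G σ hσ (Z := Y + h • W) hψ hδ'
    have hΘ := ((((σ (G.expS Y)).comp δ).hasFDerivAt.comp_hasDerivAt s
      (G.hasDerivAt_integral_AdCLM Y W s))).const_smul h
    have hfs : f h = fun s ↦ σ (G.expS (s • (Y + h • W))) (orbit G σ w ((1 - s) • Y)) -
        h • σ (G.expS Y) (δ (∫ r in (0 : ℝ)..s, G.AdCLM (G.expS ((r - 1) • Y)) W)) := by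
      rw [hf]
    rw [hfs]
    refine (hφ.sub hΘ).congr_deriv ?_
    have hinv : (G.expS ((1 - s) • Y))⁻¹ = G.expS ((s - 1) • Y) := by
      rw [← G.expS_neg, ← neg_smul, neg_sub]
    simp only [hκ, hκ₀, ContinuousLinearMap.coe_comp, Function.comp_apply, hinv, map_add,
      map_smul, G.AdCLM_expS_smul_self, map_neg, smul_sub]
    abel
  -- (iv) values of `f h` at `0` and `1`
  have hf1 : ∀ h, f h 1 = orbit G σ w (Y + h • W) - h • σ (G.expS Y) (δ (G.dexpInt Y W)) := by
    intro h
    simp only [hf, one_smul, sub_self, zero_smul, orbit_zero, RealMatrixGroup.dexpInt_apply]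
    rfl
  have hf0 : ∀ h, f h 0 = orbit G σ w Y := by
    intro h
    simp only [hf, zero_smul, G.expS_zero, map_one, one_apply_eq_self, sub_zero,
      one_smul, intervalIntegral.integral_same, map_zero, smul_zero]
  -- (v) conclusion by the mean value inequality
  rw [hasDerivAt_iff_isLittleO_nhds_zero, Asymptotics.isLittleO_iff]
  intro ε hε
  filter_upwards [Metric.tendstoUniformly_iff.1 hunif ε hε] with h hh
  have hMVI : ‖f h 1 - f h 0‖ ≤ |h| * ε := by
    refine norm_image_sub_le_of_norm_deriv_le_segment_01' (fun s _ ↦ (hderiv h s).hasDerivWithinAt)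
      fun s hs ↦ ?_
    have hs' := hh ⟨s, Set.Ico_subset_Icc_self hs⟩
    rw [dist_comm, dist_eq_norm] at hs'
    rw [norm_smul, Real.norm_eq_abs, ← hκ0]
    exact mul_le_mul_of_nonneg_left hs'.le (abs_nonneg h)
  calc ‖orbit G σ w (Y + (0 + h) • W) - orbit G σ w (Y + (0 : ℝ) • W) -
        h • σ (G.expS Y) (δ (G.dexpInt Y W))‖ = ‖f h 1 - f h 0‖ := by
        rw [hf1, hf0, zero_add, zero_smul, add_zero]
        congr 1
        abel
    _ ≤ |h| * ε := hMVI
    _ = ε * ‖h‖ := by rw [Real.norm_eq_abs, mul_comm]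

/-- **The differential of the exponential map**: `D exp (Y) W = exp Y · L(Y) W` for `Y W ∈ 𝔤`, with
`L(Y) = ∫₀¹ Ad (exp ((r - 1) Y)) dr` (`dexpInt`). Knapp, I.§10, Prop. 1.90 context;
Duhamel's formula. [folklore] -/
theorem fderiv_exp_coe_apply (Y W : G.lie.toSubmodule) :
    fderiv ℝ (fun Y : G.lie.toSubmodule ↦ exp (Y : Matrix N N A)) Y W =
      exp (Y : Matrix N N A) * (G.dexpInt Y W : Matrix N N A) := by
  have hδ : HasFDerivAt (orbit G (leftMulRep G) 1) G.lie.toSubmodule.subtypeL 0 := by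
    rw [orbit_leftMulRep_one]
    exact G.hasFDerivAt_exp_coe_zero
  have h1 := hasDerivAt_orbit_line G (leftMulRep G) (continuous_leftMulRep_apply G) hδ Y W
  rw [orbit_leftMulRep_one] at h1
  have h2 : HasDerivAt (fun t : ℝ ↦ exp ((Y + t • W : G.lie.toSubmodule) : Matrix N N A))
      (fderiv ℝ (fun Y : G.lie.toSubmodule ↦ exp (Y : Matrix N N A)) Y W) 0 := by
    have hd := (G.contDiff_exp_coe.differentiable (by simp)).differentiableAt (x := Y)
    have hl : HasDerivAt (fun t : ℝ ↦ Y + t • W) W 0 := by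
      simpa using ((hasDerivAt_id (0 : ℝ)).smul_const W).const_add Y
    exact hd.hasFDerivAt.comp_hasDerivAt_of_eq 0 hl (by simp)
  simpa using h2.unique h1

/-- `L(Y) = projL ∘ (exp (-Y) · ) ∘ D exp (Y)` as continuous linear maps. [folklore] -/
theorem dexpInt_eq (Y : G.lie.toSubmodule) :
    G.dexpInt Y = G.projL.comp ((ContinuousLinearMap.mul ℝ (Matrix N N A)
      (exp (-(Y : Matrix N N A)))).comp (fderiv ℝ (fun Y : G.lie.toSubmodule ↦
        exp (Y : Matrix N N A)) Y)) := by
  ext W : 1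
  simp only [ContinuousLinearMap.coe_comp, Function.comp_apply, ContinuousLinearMap.mul_apply',
    fderiv_exp_coe_apply, ← mul_assoc]
  rw [← exp_add_of_commute (Commute.refl (Y : Matrix N N A)).neg_left, neg_add_cancel, exp_zero,
    one_mul, RealMatrixGroup.projL_apply_coe]

/-- `Y ↦ L(Y)` is smooth. [folklore] -/
theorem contDiff_dexpInt : ContDiff ℝ ∞ fun Y : G.lie.toSubmodule ↦ G.dexpInt Y := by
  have h : (fun Y : G.lie.toSubmodule ↦ G.dexpInt Y) = fun Y : G.lie.toSubmodule ↦ G.projL.comp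
      ((ContinuousLinearMap.mul ℝ (Matrix N N A) (exp (-(Y : Matrix N N A)))).comp
        (fderiv ℝ (fun Y : G.lie.toSubmodule ↦ exp (Y : Matrix N N A)) Y)) :=
    funext (dexpInt_eq G)
  rw [h]
  refine contDiff_const.clm_comp (ContDiff.clm_comp ?_ (contDiff_infty_iff_fderiv.1
    G.contDiff_exp_coe).2)
  exact (ContinuousLinearMap.mul ℝ (Matrix N N A)).contDiff.comp
    ((contDiff_iff_contDiffAt.2 fun x ↦ (exp_analytic x).contDiffAt).comp
      G.lie.toSubmodule.subtypeL.contDiff.neg)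

/-- `Y ↦ L(Y)` is continuous. [folklore] -/
theorem continuous_dexpInt : Continuous fun Y : G.lie.toSubmodule ↦ G.dexpInt Y :=
  (contDiff_dexpInt G).continuous

/-! ## From differentiability at `0` to `C¹` -/

/-- A basis of the finite-dimensional normed Lie algebra `𝔤`. [folklore] -/
def basisS : Module.Basis (Fin (Module.finrank ℝ G.lie.toSubmodule)) ℝ G.lie.toSubmodule :=
  Module.finBasis ℝ G.lie.toSubmodule

/-- The coordinate functionals of `basisS`, as continuous linear maps. [folklore] -/
def coordS (j : Fin (Module.finrank ℝ G.lie.toSubmodule)) : G.lie.toSubmodule →L[ℝ] ℝ :=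
  LinearMap.toContinuousLinearMap ((basisS G).coord j)

/-- `coordS j Z = (basisS.repr Z) j`. [folklore] -/
@[simp]
theorem coordS_apply (j : Fin (Module.finrank ℝ G.lie.toSubmodule)) (Z : G.lie.toSubmodule) :
    coordS G j Z = (basisS G).repr Z j := rfl

omit [CompleteSpace E] in
/-- Every continuous linear map out of `𝔤` is a finite sum of rank-one operators along the basis.
[folklore] -/
theorem clm_eq_sum_smulRight (T : G.lie.toSubmodule →L[ℝ] E) :
    T = ∑ j, (coordS G j).smulRight (T (basisS G j)) := by
  ext Z : 1
  simp only [FunLike.coe_sum, Finset.sum_apply, ContinuousLinearMap.smulRight_apply,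
    coordS_apply]
  conv_lhs => rw [← (basisS G).sum_repr Z]
  simp only [map_sum, map_smul]

omit [CompleteSpace E] in
/-- The candidate derivative `Y ↦ σ (exp Y) ∘ δ ∘ L(Y)` is `C^n` as soon as the orbit maps of the
finitely many vectors `δ (basisS j)` are. [folklore] -/
theorem contDiff_candidate {n : WithTop ℕ∞} (hn : n ≤ ∞) (δ : G.lie.toSubmodule →L[ℝ] E)
    (h : ∀ j, ContDiff ℝ n (orbit G σ (δ (basisS G j)))) :
    ContDiff ℝ n fun Y : G.lie.toSubmodule ↦ (σ (G.expS Y)).comp (δ.comp (G.dexpInt Y)) := by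
  have hfun : (fun Y : G.lie.toSubmodule ↦ (σ (G.expS Y)).comp (δ.comp (G.dexpInt Y))) =
      fun Y ↦ (∑ j, ContinuousLinearMap.smulRightL ℝ G.lie.toSubmodule E (coordS G j)
        (orbit G σ (δ (basisS G j)) Y)).comp (G.dexpInt Y) := by
    funext Y
    rw [← ContinuousLinearMap.comp_assoc, clm_eq_sum_smulRight G ((σ (G.expS Y)).comp δ)]
    rfl
  rw [hfun]
  refine ContDiff.clm_comp (ContDiff.sum fun j _ ↦ ?_) ((contDiff_dexpInt G).of_le hn)
  exact (ContinuousLinearMap.smulRightL ℝ G.lie.toSubmodule E (coordS G j)).contDiff.comp (h j)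

omit [CompleteSpace E] in
/-- The candidate derivative is continuous for a strongly continuous representation. [folklore] -/
theorem continuous_candidate (hσ : ∀ v, Continuous fun g : G.carrier ↦ σ g v)
    (δ : G.lie.toSubmodule →L[ℝ] E) :
    Continuous fun Y : G.lie.toSubmodule ↦ (σ (G.expS Y)).comp (δ.comp (G.dexpInt Y)) :=
  (contDiff_candidate G σ (by simp) δ fun j ↦
    contDiff_zero.2 (continuous_orbit G σ hσ _)).continuous

/-- **`C¹`-propagation.** If `Y ↦ σ (exp Y) w` is differentiable at `0` with derivative `δ`, then
it is differentiable at every `Y ∈ 𝔤`, with derivative `σ (exp Y) ∘ δ ∘ L(Y)` (Duhamel's formula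
plus the mean value inequality). Wallach, §1.6.1–1.6.2 context. [folklore] -/
theorem hasFDerivAt_orbit (hσ : ∀ v, Continuous fun g : G.carrier ↦ σ g v) {w : E}
    {δ : G.lie.toSubmodule →L[ℝ] E} (hδ : HasFDerivAt (orbit G σ w) δ 0)
    (Y : G.lie.toSubmodule) :
    HasFDerivAt (orbit G σ w) ((σ (G.expS Y)).comp (δ.comp (G.dexpInt Y))) Y := by
  obtain ⟨D, hD⟩ : ∃ D : G.lie.toSubmodule → G.lie.toSubmodule →L[ℝ] E,
      D = fun Y ↦ (σ (G.expS Y)).comp (δ.comp (G.dexpInt Y)) := ⟨_, rfl⟩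
  have hDc : Continuous D := hD ▸ continuous_candidate G σ hσ δ
  -- line derivatives everywhere
  have hline : ∀ (W : G.lie.toSubmodule) (t : ℝ),
      HasDerivAt (fun u : ℝ ↦ orbit G σ w (Y + u • W)) (D (Y + t • W) W) t := fun W t ↦ by
    have h1 : HasDerivAt (fun u : ℝ ↦ orbit G σ w ((Y + t • W) + u • W)) (D (Y + t • W) W)
        (-t + t) := by
      rw [neg_add_cancel, hD]
      exact hasDerivAt_orbit_line G σ hσ hδ (Y + t • W) W
    have h2 := HasDerivAt.comp_const_add (-t) t h1
    refine h2.congr_of_eventuallyEq (Eventually.of_forall fun u ↦ ?_)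
    show orbit G σ w (Y + u • W) = orbit G σ w ((Y + t • W) + (-t + u) • W)
    congr 1
    simp only [add_smul, neg_smul]
    abel
  rw [show (σ (G.expS Y)).comp (δ.comp (G.dexpInt Y)) = D Y by rw [hD],
    hasFDerivAt_iff_isLittleO_nhds_zero, Asymptotics.isLittleO_iff]
  intro ε hε
  obtain ⟨r, hr, hrε⟩ := (NormedAddCommGroup.tendsto_nhds_nhds (f := D)).1 (hDc.tendsto Y) ε hε
  filter_upwards [Metric.ball_mem_nhds (0 : G.lie.toSubmodule) hr] with W hW
  have hW' : ‖W‖ < r := by simpa using hW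
  have hMVI : ‖(orbit G σ w (Y + (1 : ℝ) • W) - (1 : ℝ) • D Y W) -
      (orbit G σ w (Y + (0 : ℝ) • W) - (0 : ℝ) • D Y W)‖ ≤ ε * ‖W‖ := by
    refine norm_image_sub_le_of_norm_deriv_le_segment_01'
      (f := fun t : ℝ ↦ orbit G σ w (Y + t • W) - t • D Y W)
      (fun t _ ↦ ((hline W t).sub ((hasDerivAt_id t).smul_const (D Y W))).hasDerivWithinAt)
      fun t ht ↦ ?_
    have hdist : ‖Y + t • W - Y‖ < r := by
      rw [add_sub_cancel_left, norm_smul, Real.norm_eq_abs, abs_of_nonneg ht.1]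
      exact (mul_le_of_le_one_left (norm_nonneg _) ht.2.le).trans_lt hW'
    have hD' : ‖D (Y + t • W) - D Y‖ < ε := hrε _ hdist
    rw [one_smul, ← sub_apply]
    exact (ContinuousLinearMap.le_opNorm _ _).trans
      (mul_le_mul_of_nonneg_right hD'.le (norm_nonneg _))
  simp only [one_smul, zero_smul, add_zero, sub_zero] at hMVI
  calc ‖orbit G σ w (Y + W) - orbit G σ w Y - D Y W‖
        = ‖orbit G σ w (Y + W) - D Y W - orbit G σ w Y‖ := by congr 1; abel
    _ ≤ ε * ‖W‖ := hMVI

/-- **`C¹`-propagation**, global form: differentiability of `Y ↦ σ (exp Y) w` at `0` implies it is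
`C¹` on `𝔤`. Wallach, §1.6.1–1.6.2 context. [folklore] -/
theorem contDiff_one_orbit (hσ : ∀ v, Continuous fun g : G.carrier ↦ σ g v) {w : E}
    {δ : G.lie.toSubmodule →L[ℝ] E} (hδ : HasFDerivAt (orbit G σ w) δ 0) :
    ContDiff ℝ 1 (orbit G σ w) :=
  contDiff_one_iff_hasFDerivAt.2
    ⟨_, continuous_candidate G σ hσ δ, fun Y ↦ hasFDerivAt_orbit G σ hσ hδ Y⟩

/-! ## Higher regularity: `exp`-smooth vectors are stable under the differential -/

/-- `L(Y)` is invertible for `Y` near `0`. [folklore] -/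
theorem eventually_isUnit_dexpInt :
    ∀ᶠ Y in 𝓝 (0 : G.lie.toSubmodule), IsUnit (G.dexpInt Y) := by
  have h : ContinuousAt (fun Y : G.lie.toSubmodule ↦ G.dexpInt Y) 0 :=
    (continuous_dexpInt G).continuousAt
  have hmem : {T : G.lie.toSubmodule →L[ℝ] G.lie.toSubmodule | IsUnit T} ∈ 𝓝 (G.dexpInt 0) := by
    rw [RealMatrixGroup.dexpInt_zero]
    exact (Units.isOpen (R := G.lie.toSubmodule →L[ℝ] G.lie.toSubmodule)).mem_nhds isUnit_one
  exact h.preimage_mem_nhds hmem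

/-- Near `0`, the orbit map of the derived vector `δ X` is obtained from the derivative of the orbit
map of `w`: `σ (exp Y) (δ X) = D(σ (exp ·) w)(Y) (L(Y)⁻¹ X)`. Wallach, §1.6.2 context. [folklore] -/
theorem orbit_fderiv_eventuallyEq (hσ : ∀ v, Continuous fun g : G.carrier ↦ σ g v) {w : E}
    {δ : G.lie.toSubmodule →L[ℝ] E} (hδ : HasFDerivAt (orbit G σ w) δ 0)
    (X : G.lie.toSubmodule) :
    orbit G σ (δ X) =ᶠ[𝓝 0]
      fun Y ↦ fderiv ℝ (orbit G σ w) Y (Ring.inverse (G.dexpInt Y) X) := by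
  filter_upwards [eventually_isUnit_dexpInt G] with Y hY
  rw [(hasFDerivAt_orbit G σ hσ hδ Y).fderiv, orbit_apply]
  simp only [ContinuousLinearMap.coe_comp, Function.comp_apply]
  rw [← mul_apply_eq_comp (G.dexpInt Y), Ring.mul_inverse_cancel _ hY, one_apply_eq_self]

/-- **Regularity propagation.** If `Y ↦ σ (exp Y) w` is `C^{k+1}` near `0`, then it is `C^{k+1}` on
all of `𝔤`, and the orbit maps of the derived vectors `D(σ (exp ·) w)(0) X` are `C^k` on `𝔤`.
(Induction on `k`, using `C¹`-propagation and `orbit_fderiv_eventuallyEq`.)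
Harish-Chandra 1953, §9 and Wallach, §1.6.2 (Lemma) context. [folklore] -/
theorem contDiff_orbit_induction (hσ : ∀ v, Continuous fun g : G.carrier ↦ σ g v) (k : ℕ) :
    ∀ w : E, (∀ᶠ Y in 𝓝 (0 : G.lie.toSubmodule),
      ContDiffAt ℝ ((k : WithTop ℕ∞) + 1) (orbit G σ w) Y) →
      ContDiff ℝ ((k : WithTop ℕ∞) + 1) (orbit G σ w) ∧
        ∀ X, ContDiff ℝ (k : WithTop ℕ∞) (orbit G σ (fderiv ℝ (orbit G σ w) 0 X)) := by
  induction k with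
  | zero =>
    intro w hw
    have hδ : HasFDerivAt (orbit G σ w) (fderiv ℝ (orbit G σ w) 0) 0 :=
      (hw.self_of_nhds.differentiableAt (by simp)).hasFDerivAt
    refine ⟨by simpa using contDiff_one_orbit G σ hσ hδ, fun X ↦ ?_⟩
    rw [Nat.cast_zero]
    exact contDiff_zero.2 (continuous_orbit G σ hσ _)
  | succ k ih =>
    intro w hw
    have hδ : HasFDerivAt (orbit G σ w) (fderiv ℝ (orbit G σ w) 0) 0 :=
      (hw.self_of_nhds.differentiableAt (by simp)).hasFDerivAt
    have h2 : ∀ X, ContDiff ℝ ((k : WithTop ℕ∞) + 1) (orbit G σ (fderiv ℝ (orbit G σ w) 0 X)) := by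
      intro X
      refine (ih _ ?_).1
      filter_upwards [(orbit_fderiv_eventuallyEq G σ hσ hδ X).eventuallyEq_nhds,
        eventually_isUnit_dexpInt G, hw] with Y hY hYU hwY
      refine ContDiffAt.congr_of_eventuallyEq ?_ hY
      have hf : ContDiffAt ℝ ((k : WithTop ℕ∞) + 1) (fderiv ℝ (orbit G σ w)) Y :=
        hwY.fderiv_right (by push_cast; exact le_rfl)
      have hi : ContDiffAt ℝ ((k : WithTop ℕ∞) + 1) (fun Y ↦ Ring.inverse (G.dexpInt Y) X) Y := by
        obtain ⟨u, hu⟩ := hYU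
        have h1 : ContDiffAt ℝ ((k : WithTop ℕ∞) + 1) Ring.inverse (G.dexpInt Y) := by
          rw [← hu]
          exact contDiffAt_ringInverse ℝ (R := G.lie.toSubmodule →L[ℝ] G.lie.toSubmodule) u
        exact (h1.comp Y ((contDiff_dexpInt G).of_le (mod_cast le_top)).contDiffAt).clm_apply
          contDiffAt_const
      exact hf.clm_apply hi
    refine ⟨?_, by simpa [Nat.cast_succ] using h2⟩
    rw [contDiff_succ_iff_hasFDerivAt]
    refine ⟨_, ?_, fun Y ↦ hasFDerivAt_orbit G σ hσ hδ Y⟩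
    rw [Nat.cast_succ]
    exact contDiff_candidate G σ (mod_cast le_top) _ fun j ↦ h2 _

/-- **`exp`-smooth vectors are stable under the differential**: if `Y ↦ σ (exp Y) w` is smooth on
`𝔤`, so is `Y ↦ σ (exp Y) u` for every derived vector `u = D(σ (exp ·) w)(0) X`, `X ∈ 𝔤`.
Harish-Chandra 1953, §7 (p. 209) and §9; Wallach, §1.6.2 (Lemma). [folklore] -/
theorem contDiff_orbit_fderiv (hσ : ∀ v, Continuous fun g : G.carrier ↦ σ g v) {w : E}
    (hw : ContDiff ℝ ∞ (orbit G σ w)) (X : G.lie.toSubmodule) :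
    ContDiff ℝ ∞ (orbit G σ (fderiv ℝ (orbit G σ w) 0 X)) := by
  rw [contDiff_infty]
  intro k
  exact (contDiff_orbit_induction G σ hσ k w (Eventually.of_forall fun Y ↦
    (hw.of_le (mod_cast le_top)).contDiffAt)).2 X

/-- Smoothness along `exp` near `0` already implies smoothness on all of `𝔤`. [folklore] -/
theorem contDiff_orbit_of_eventually (hσ : ∀ v, Continuous fun g : G.carrier ↦ σ g v) {w : E}
    (hw : ∀ᶠ Y in 𝓝 (0 : G.lie.toSubmodule), ContDiffAt ℝ ∞ (orbit G σ w) Y) :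
    ContDiff ℝ ∞ (orbit G σ w) := by
  rw [contDiff_infty]
  intro k
  refine ((contDiff_orbit_induction G σ hσ k w ?_).1).of_le (by simp)
  filter_upwards [hw] with Y hY using hY.of_le (mod_cast le_top)

/-! ## The bracket relation -/

/-- The derivative of `Y ↦ L(Y)` at `0`: `(DL(0) V) V' = projL (D²exp(0)(V, V') - V V')`. [folklore] -/
theorem fderiv_dexpInt_zero_apply (V V' : G.lie.toSubmodule) :
    fderiv ℝ (fun Y : G.lie.toSubmodule ↦ G.dexpInt Y) 0 V V' =
      G.projL (fderiv ℝ (fderiv ℝ (fun Y : G.lie.toSubmodule ↦ exp (Y : Matrix N N A))) 0 V V' -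
        (V : Matrix N N A) * V') := by
  set expc : G.lie.toSubmodule → Matrix N N A := fun Y ↦ exp (Y : Matrix N N A) with hexpc
  have hsm : ContDiff ℝ ∞ expc := G.contDiff_exp_coe
  have hE₂ : HasFDerivAt (fderiv ℝ expc) (fderiv ℝ (fderiv ℝ expc) 0) 0 :=
    (((contDiff_infty_iff_fderiv.1 hsm).2.differentiable (by simp)) 0).hasFDerivAt
  have hD₁0 : fderiv ℝ expc 0 = G.lie.toSubmodule.subtypeL := G.hasFDerivAt_exp_coe_zero.fderiv
  have hDL : HasFDerivAt (fun Y : G.lie.toSubmodule ↦ G.dexpInt Y)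
      (fderiv ℝ (fun Y : G.lie.toSubmodule ↦ G.dexpInt Y) 0) 0 :=
    (((contDiff_dexpInt G).differentiable (by simp)) 0).hasFDerivAt
  have hl : HasDerivAt (fun t : ℝ ↦ t • V) V 0 := by
    simpa using (hasDerivAt_id (0 : ℝ)).smul_const V
  -- the line derivative, abstractly
  have h1 : HasDerivAt (fun t : ℝ ↦ G.dexpInt (t • V) V')
      (fderiv ℝ (fun Y : G.lie.toSubmodule ↦ G.dexpInt Y) 0 V V') 0 :=
    ((ContinuousLinearMap.apply ℝ G.lie.toSubmodule V').hasFDerivAt.comp 0 hDL).comp_hasDerivAt_of_eq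
      0 hl (by simp)
  -- the line derivative, computed
  have ha : HasDerivAt (fun t : ℝ ↦ exp (-(t • (V : Matrix N N A)))) (-(V : Matrix N N A)) 0 := by
    have := hasDerivAt_exp_smul_const (𝕂 := ℝ) (-(V : Matrix N N A)) 0
    simp only [zero_smul, smul_neg, neg_zero, exp_zero, one_mul] at this
    exact this
  have hb : HasDerivAt (fun t : ℝ ↦ fderiv ℝ expc (t • V) V')
      (fderiv ℝ (fderiv ℝ expc) 0 V V') 0 :=
    ((ContinuousLinearMap.apply ℝ (Matrix N N A) V').hasFDerivAt.comp 0 hE₂).comp_hasDerivAt_of_eq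
      0 hl (by simp)
  have hab := G.projL.hasFDerivAt.comp_hasDerivAt 0 (ha.mul hb)
  have h2 : HasDerivAt (fun t : ℝ ↦ G.dexpInt (t • V) V')
      (G.projL (fderiv ℝ (fderiv ℝ expc) 0 V V' - (V : Matrix N N A) * V')) 0 := by
    have hfun : (fun t : ℝ ↦ G.dexpInt (t • V) V') = G.projL ∘
        fun t : ℝ ↦ exp (-(t • (V : Matrix N N A))) * fderiv ℝ expc (t • V) V' := by
      funext t
      rw [dexpInt_eq]
      simp [hexpc]
    rw [hfun]
    refine hab.congr_deriv ?_
    simp only [zero_smul, neg_zero, exp_zero, one_mul, hD₁0, Submodule.subtypeL_apply]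
    rw [neg_mul, sub_eq_add_neg, add_comm]
  exact h1.unique h2

/-- The antisymmetrisation of `DL(0)` is the commutator: `(DL(0) X') X - (DL(0) X) X' = ⁅X, X'⁆`.
[folklore] -/
theorem fderiv_dexpInt_zero_antisymm (X X' : G.lie.toSubmodule) :
    fderiv ℝ (fun Y : G.lie.toSubmodule ↦ G.dexpInt Y) 0 X' X -
      fderiv ℝ (fun Y : G.lie.toSubmodule ↦ G.dexpInt Y) 0 X X' = G.brS X X' := by
  set expc : G.lie.toSubmodule → Matrix N N A := fun Y ↦ exp (Y : Matrix N N A) with hexpc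
  have hsm : ContDiff ℝ ∞ expc := G.contDiff_exp_coe
  have hdiff : Differentiable ℝ expc := hsm.differentiable (by simp)
  have hE₂ : HasFDerivAt (fderiv ℝ expc) (fderiv ℝ (fderiv ℝ expc) 0) 0 :=
    (((contDiff_infty_iff_fderiv.1 hsm).2.differentiable (by simp)) 0).hasFDerivAt
  have symm : fderiv ℝ (fderiv ℝ expc) 0 X X' = fderiv ℝ (fderiv ℝ expc) 0 X' X :=
    second_derivative_symmetric_of_eventually
      (Eventually.of_forall fun Y ↦ (hdiff Y).hasFDerivAt) hE₂ X X'
  rw [fderiv_dexpInt_zero_apply, fderiv_dexpInt_zero_apply, ← map_sub, ← symm]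
  rw [show fderiv ℝ (fderiv ℝ expc) 0 X X' - (X' : Matrix N N A) * X -
      (fderiv ℝ (fderiv ℝ expc) 0 X X' - (X : Matrix N N A) * X') = G.brS X X' by
    rw [RealMatrixGroup.coe_brS]; abel]
  exact G.projL_apply_coe _

/-- **The differential is a Lie algebra action on `exp`-smooth vectors.** Writing
`δ_v := D(σ (exp ·) v)(0)`, for `w` with smooth orbit map:
`δ_{δ_w X'} X - δ_{δ_w X} X' = δ_w ⁅X, X'⁆`. Harish-Chandra 1953, §7 (p. 209:
`π(⁅X, Y⁆) = π(X) π(Y) − π(Y) π(X)` on well-behaved vectors); Wallach, §1.6.2. [folklore] -/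
theorem fderiv_orbit_bracket (hσ : ∀ v, Continuous fun g : G.carrier ↦ σ g v) {w : E}
    (hw : ContDiff ℝ ∞ (orbit G σ w)) (X X' : G.lie.toSubmodule) :
    fderiv ℝ (orbit G σ (fderiv ℝ (orbit G σ w) 0 X')) 0 X -
      fderiv ℝ (orbit G σ (fderiv ℝ (orbit G σ w) 0 X)) 0 X' =
        fderiv ℝ (orbit G σ w) 0 (G.brS X X') := by
  have hdiff : Differentiable ℝ (orbit G σ w) := hw.differentiable (by simp)
  have hδ : HasFDerivAt (orbit G σ w) (fderiv ℝ (orbit G σ w) 0) 0 := (hdiff 0).hasFDerivAt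
  have hD2 : HasFDerivAt (fderiv ℝ (orbit G σ w)) (fderiv ℝ (fderiv ℝ (orbit G σ w)) 0) 0 :=
    (((contDiff_infty_iff_fderiv.1 hw).2.differentiable (by simp)) 0).hasFDerivAt
  have symm1 : ∀ V V', fderiv ℝ (fderiv ℝ (orbit G σ w)) 0 V V' =
      fderiv ℝ (fderiv ℝ (orbit G σ w)) 0 V' V := fun V V' ↦
    second_derivative_symmetric_of_eventually
      (Eventually.of_forall fun Y ↦ (hdiff Y).hasFDerivAt) hD2 V V'
  have hDL : HasFDerivAt (fun Y : G.lie.toSubmodule ↦ G.dexpInt Y)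
      (fderiv ℝ (fun Y : G.lie.toSubmodule ↦ G.dexpInt Y) 0) 0 :=
    (((contDiff_dexpInt G).differentiable (by simp)) 0).hasFDerivAt
  -- the inverse `Y ↦ L(Y)⁻¹` near `0` and the values of its derivative at `0`
  have hLi : DifferentiableAt ℝ
      (fun Y : G.lie.toSubmodule ↦ Ring.inverse (G.dexpInt Y)) 0 := by
    have hU : IsUnit (G.dexpInt 0) := by
      rw [RealMatrixGroup.dexpInt_zero]; exact isUnit_one
    obtain ⟨u, hu⟩ := hU
    have h1 : ContDiffAt ℝ 1 Ring.inverse (G.dexpInt 0) := by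
      rw [← hu]
      exact contDiffAt_ringInverse ℝ (R := G.lie.toSubmodule →L[ℝ] G.lie.toSubmodule) u
    exact (h1.differentiableAt one_ne_zero).comp (0 : G.lie.toSubmodule) hDL.differentiableAt
  have hg : ∀ V' : G.lie.toSubmodule, DifferentiableAt ℝ
      (fun Y : G.lie.toSubmodule ↦ Ring.inverse (G.dexpInt Y) V') 0 := fun V' ↦
    hLi.clm_apply (differentiableAt_const V')
  have hval : ∀ V V' : G.lie.toSubmodule,
      fderiv ℝ (fun Y : G.lie.toSubmodule ↦ Ring.inverse (G.dexpInt Y) V') 0 V =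
        -(fderiv ℝ (fun Y : G.lie.toSubmodule ↦ G.dexpInt Y) 0 V V') := by
    intro V V'
    have hP := hDL.clm_apply (hg V').hasFDerivAt
    have hconst : HasFDerivAt
        (fun Y : G.lie.toSubmodule ↦ G.dexpInt Y (Ring.inverse (G.dexpInt Y) V'))
        (0 : G.lie.toSubmodule →L[ℝ] G.lie.toSubmodule) 0 := by
      refine (hasFDerivAt_const V' 0).congr_of_eventuallyEq ?_
      filter_upwards [eventually_isUnit_dexpInt G] with Y hY
      rw [← mul_apply_eq_comp, Ring.mul_inverse_cancel _ hY, one_apply_eq_self]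
    have h := congrArg (fun T : G.lie.toSubmodule →L[ℝ] G.lie.toSubmodule ↦ T V) (hP.unique hconst)
    simp only [add_apply, ContinuousLinearMap.coe_comp, Function.comp_apply,
      ContinuousLinearMap.flip_apply, RealMatrixGroup.dexpInt_zero, Ring.inverse_one,
      one_apply_eq_self, zero_apply] at h
    exact eq_neg_of_add_eq_zero_left h
  -- key formula: `δ_{δ_w V'} V = D²(V, V') - δ_w (DL(0) V V')`
  have key : ∀ V V' : G.lie.toSubmodule,
      fderiv ℝ (orbit G σ (fderiv ℝ (orbit G σ w) 0 V')) 0 V =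
        fderiv ℝ (fderiv ℝ (orbit G σ w)) 0 V V' -
          fderiv ℝ (orbit G σ w) 0 (fderiv ℝ (fun Y : G.lie.toSubmodule ↦ G.dexpInt Y) 0 V V') := by
    intro V V'
    rw [(orbit_fderiv_eventuallyEq G σ hσ hδ V').fderiv_eq, (hD2.clm_apply (hg V').hasFDerivAt).fderiv]
    simp only [add_apply, ContinuousLinearMap.coe_comp, Function.comp_apply,
      ContinuousLinearMap.flip_apply, RealMatrixGroup.dexpInt_zero, Ring.inverse_one,
      one_apply_eq_self, hval, map_neg]
    abel
  rw [key, key, symm1 X' X, ← fderiv_dexpInt_zero_antisymm G X X', map_sub]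
  abel

end Banach

end ExpOrbit

/-! ## Application to a Banach representation: the Harish-Chandra module -/

section HarishChandraModule

variable {H : Type*} [NormedAddCommGroup H] [NormedSpace ℂ H]
  (π : ContRepresentation ℂ G.carrier H)

/-- `π` viewed as a representation by real-linear operators (the analytic lemmas above are stated
over `ℝ`). [folklore] -/
def realRep : G.carrier →* (H →L[ℝ] H) where
  toFun g := (π g).restrictScalars ℝ
  map_one' := by ext; simp
  map_mul' g h := by ext; simp [mul_apply_eq_comp]

/-- `realRep π g x = π g x`. [folklore] -/
@[simp]
theorem realRep_apply (g : G.carrier) (x : H) : realRep G π g x = π g x := rfl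

/-- The orbit map of `realRep π` along `exp` is the map whose smoothness defines `smoothVectors`.
[folklore] -/
theorem orbit_realRep (v : H) :
    ExpOrbit.orbit G (realRep G π) v = fun X : G.lie.toSubmodule ↦ π (G.expMem ⟨X, X.2⟩) v := rfl

/-- Smooth vectors are exactly the vectors with smooth `exp`-orbit map for `realRep π`. [folklore] -/
theorem mem_smoothVectors_iff_contDiff_orbit (v : H) :
    v ∈ smoothVectors G π ↔ ContDiff ℝ ∞ (ExpOrbit.orbit G (realRep G π) v) :=
  Iff.rfl

/-- Unpacking membership in `smoothVectors`. [folklore] -/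
theorem contDiff_of_mem_smoothVectors {v : H} (hv : v ∈ smoothVectors G π) :
    ContDiff ℝ ∞ (ExpOrbit.orbit G (realRep G π) v) :=
  hv

/-- Smooth vectors have `exp`-orbit maps differentiable at `0`. [folklore] -/
theorem differentiableAt_of_mem_smoothVectors {v : H} (hv : v ∈ smoothVectors G π) :
    DifferentiableAt ℝ (ExpOrbit.orbit G (realRep G π) v) 0 :=
  (contDiff_of_mem_smoothVectors G π hv).differentiable (by simp) 0

/-- Strong continuity of `π` is strong continuity of `realRep π`. [folklore] -/
theorem continuous_realRep_apply (hπ : π.IsStronglyContinuous) (v : H) :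
    Continuous fun g : G.carrier ↦ realRep G π g v :=
  hπ v

/-- `orbit` is homogeneous for complex scalars. [folklore] -/
theorem orbit_realRep_smul (c : ℂ) (v : H) :
    ExpOrbit.orbit G (realRep G π) (c • v) = c • ExpOrbit.orbit G (realRep G π) v := by
  funext Y
  simp [ExpOrbit.orbit_apply]

/-- The differential `dπ(X) v := D(Y ↦ π(exp Y) v)(0) X` of `π` at a vector `v` (meaningful for
smooth `v`). Harish-Chandra 1953, §7 (p. 209); Wallach, §1.6.1. [folklore] -/
def dπ (v : H) (X : G.lie) : H :=
  fderiv ℝ (ExpOrbit.orbit G (realRep G π) v) 0 ⟨X, X.2⟩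

/-- Unfolding `dπ`. [folklore] -/
theorem dπ_def (v : H) (X : G.lie) :
    dπ G π v X = fderiv ℝ (ExpOrbit.orbit G (realRep G π) v) 0 ⟨X, X.2⟩ := rfl

/-- `dπ` is additive in `X`. [folklore] -/
theorem dπ_add_right (v : H) (X Y : G.lie) : dπ G π v (X + Y) = dπ G π v X + dπ G π v Y := by
  rw [dπ_def, dπ_def, dπ_def, ← map_add]
  rfl

/-- `dπ` is real-homogeneous in `X`. [folklore] -/
theorem dπ_smul_right (v : H) (t : ℝ) (X : G.lie) : dπ G π v (t • X) = t • dπ G π v X := by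
  rw [dπ_def, dπ_def, ← map_smul]
  rfl

/-- `dπ` is additive in `v` on smooth vectors. [folklore] -/
theorem dπ_add_left {v w : H} (hv : v ∈ smoothVectors G π) (hw : w ∈ smoothVectors G π)
    (X : G.lie) : dπ G π (v + w) X = dπ G π v X + dπ G π w X := by
  rw [dπ_def, dπ_def, dπ_def, ExpOrbit.orbit_add,
    fderiv_add (differentiableAt_of_mem_smoothVectors G π hv)
      (differentiableAt_of_mem_smoothVectors G π hw)]
  rfl

/-- `dπ` is complex-homogeneous in `v` on smooth vectors. [folklore] -/
theorem dπ_smul_left {v : H} (hv : v ∈ smoothVectors G π) (c : ℂ) (X : G.lie) :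
    dπ G π (c • v) X = c • dπ G π v X := by
  rw [dπ_def, dπ_def, orbit_realRep_smul,
    fderiv_const_smul (differentiableAt_of_mem_smoothVectors G π hv)]
  rfl

/-- **`dπ(X) v` is the derivative of `t ↦ π(exp tX) v` at `0`** for a vector `v` whose
`exp`-orbit map is differentiable at `0` (in particular for smooth `v`). Harish-Chandra 1953, §7
(p. 209) and §9 (p. 225); Wallach, §1.6.1. [folklore] -/
theorem hasDerivAt_dπ {v : H} (hv : DifferentiableAt ℝ (ExpOrbit.orbit G (realRep G π) v) 0)
    (X : G.lie) :
    HasDerivAt (fun t : ℝ ↦ π (G.expMem (t • X)) v) (dπ G π v X) 0 := by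
  have h := ExpOrbit.hasDerivAt_orbit_smul G (realRep G π) hv.hasFDerivAt ⟨X, X.2⟩ 0
  rw [zero_smul, RealMatrixGroup.expS_zero, map_one, one_apply_eq_self] at h
  exact h

/-- Equivariance: `π(k) dπ(X) v = dπ(Ad(k) X) (π(k) v)` for smooth `v`. Wallach, §1.6.2.
[folklore] -/
theorem apply_dπ {v : H} (hv : v ∈ smoothVectors G π) (g : G.carrier) (X : G.lie) :
    π g (dπ G π v X) = dπ G π (π g v) (G.Ad g X) := by
  have hδ := (differentiableAt_of_mem_smoothVectors G π hv).hasFDerivAt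
  have h2 : HasFDerivAt (ExpOrbit.orbit G (realRep G π) (π g v)) ((realRep G π g).comp
      ((fderiv ℝ (ExpOrbit.orbit G (realRep G π) v) 0).comp (G.AdCLM g⁻¹))) 0 :=
    ExpOrbit.hasFDerivAt_orbit_conj G (realRep G π) hδ g
  rw [dπ_def, dπ_def, h2.fderiv]
  simp only [ContinuousLinearMap.coe_comp, Function.comp_apply, realRep_apply]
  congr 2
  rw [show (⟨(G.Ad g X : Matrix N N A), (G.Ad g X).2⟩ : G.lie.toSubmodule) = G.AdCLM g ⟨X, X.2⟩
    from rfl, ← ContinuousLinearMap.comp_apply, ← RealMatrixGroup.AdCLM_mul, inv_mul_cancel,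
    RealMatrixGroup.AdCLM_one]
  rfl

section Smooth

variable [CompleteSpace H] [FiniteDimensional ℝ A]

/-- **Smooth vectors are stable under `dπ`.** Harish-Chandra 1953, §7 (p. 209: `π(X)ψ ∈ W`) and
§9; Wallach, §1.6.2 (Lemma). [folklore] -/
theorem dπ_mem_smoothVectors (hπ : π.IsStronglyContinuous) {v : H} (hv : v ∈ smoothVectors G π)
    (X : G.lie) : dπ G π v X ∈ smoothVectors G π :=
  ExpOrbit.contDiff_orbit_fderiv G (realRep G π) (continuous_realRep_apply G π hπ)
    (contDiff_of_mem_smoothVectors G π hv) ⟨X, X.2⟩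

/-- **`dπ` preserves the Harish-Chandra space** (smooth `K`-finite vectors): `K`-finiteness is
preserved because `π(k) dπ(X) w = dπ(Ad(k)X) (π(k) w)` and `dim 𝔤 < ∞`.
Harish-Chandra 1953, §9 (p. 225); Wallach, Lemma 3.3.3. [folklore] -/
theorem dπ_mem_harishChandraSpace (hπ : π.IsStronglyContinuous) {v : H}
    (hv : v ∈ harishChandraSpace G π) (X : G.lie) :
    dπ G π v X ∈ harishChandraSpace G π := by
  refine ⟨dπ_mem_smoothVectors G π hπ hv.1 X, ?_⟩
  -- the finite-dimensional `K`-stable space spanned by the `K`-orbit of `v`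
  set W₀ : Submodule ℂ H := kOrbitSpan G π v with hW₀
  haveI : FiniteDimensional ℂ W₀ := hv.2
  have hW₀s : W₀ ≤ smoothVectors G π := by
    refine Submodule.span_le.2 ?_
    rintro _ ⟨k, rfl⟩
    exact apply_mem_smoothVectors G π _ hv.1
  have hW₀K : ∀ (k : G.maximalCompact), ∀ w ∈ W₀,
      π (Subgroup.inclusion G.maximalCompact_le_carrier k) w ∈ W₀ := by
    intro k w hw
    refine Submodule.span_induction ?_ ?_ ?_ ?_ hw
    · rintro _ ⟨k', rfl⟩
      rw [← mul_apply_eq_comp, ← map_mul, ← map_mul]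
      exact apply_mem_kOrbitSpan G π _ v
    · simp
    · intro x y _ _ hx hy
      rw [map_add]
      exact Submodule.add_mem _ hx hy
    · intro c x _ hx
      rw [map_smul]
      exact Submodule.smul_mem _ c hx
  -- the linear maps `w ↦ dπ(b_j) w` on `W₀` and the finite-dimensional space `U` they span
  let T : G.lie.toSubmodule → W₀ →ₗ[ℂ] H := fun Z ↦
    { toFun := fun w ↦ dπ G π (w : H) ⟨Z, Z.2⟩
      map_add' := fun w₁ w₂ ↦ dπ_add_left G π (hW₀s w₁.2) (hW₀s w₂.2) _
      map_smul' := fun c w ↦ dπ_smul_left G π (hW₀s w.2) c _ }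
  set U : Submodule ℂ H := ⨆ j, LinearMap.range (T (ExpOrbit.basisS G j)) with hU
  have hTU : ∀ (j) (w : H) (hw : w ∈ W₀), dπ G π w ⟨ExpOrbit.basisS G j, (ExpOrbit.basisS G j).2⟩ ∈ U :=
    fun j w hw ↦ Submodule.mem_iSup_of_mem j ⟨⟨w, hw⟩, rfl⟩
  -- expansion of `dπ(Z) w` along the basis of `𝔤`
  have hexp : ∀ (w : H) (Z : G.lie.toSubmodule), dπ G π w ⟨Z, Z.2⟩ =
      ∑ j, (ExpOrbit.basisS G).repr Z j • dπ G π w ⟨ExpOrbit.basisS G j, (ExpOrbit.basisS G j).2⟩ := by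
    intro w Z
    have h := congrArg (fun T : G.lie.toSubmodule →L[ℝ] H ↦ T Z)
      (ExpOrbit.clm_eq_sum_smulRight G (E := H) (fderiv ℝ (ExpOrbit.orbit G (realRep G π) w) 0))
    simpa [dπ_def] using h
  have hmemU : ∀ (w : H) (hw : w ∈ W₀) (Z : G.lie.toSubmodule), dπ G π w ⟨Z, Z.2⟩ ∈ U := by
    intro w hw Z
    rw [hexp]
    exact Submodule.sum_mem _ fun j _ ↦ Submodule.smul_of_tower_mem _ _ (hTU j w hw)
  -- the `K`-orbit of `dπ(X) v` lies in `U`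
  haveI : FiniteDimensional ℂ U := Submodule.finiteDimensional_iSup _
  refine Submodule.finiteDimensional_of_le (Submodule.span_le.2 ?_ : kOrbitSpan G π _ ≤ U)
  rintro _ ⟨k, rfl⟩
  dsimp only
  rw [apply_dπ G π hv.1]
  exact hmemU _ (hW₀K k v (Submodule.subset_span ⟨1, by simp⟩)) ⟨_, (G.Ad _ X).2⟩

/-- **The bracket relation** `dπ(⁅X, Y⁆) v = dπ(X) dπ(Y) v − dπ(Y) dπ(X) v` on smooth vectors.
Harish-Chandra 1953, §7 (p. 209); Wallach, §1.6.2. [folklore] -/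
theorem dπ_lie (hπ : π.IsStronglyContinuous) {v : H} (hv : v ∈ smoothVectors G π) (X Y : G.lie) :
    dπ G π v ⁅X, Y⁆ = dπ G π (dπ G π v Y) X - dπ G π (dπ G π v X) Y := by
  have h := ExpOrbit.fderiv_orbit_bracket G (realRep G π) (continuous_realRep_apply G π hπ)
    (contDiff_of_mem_smoothVectors G π hv) ⟨X, X.2⟩ ⟨Y, Y.2⟩
  rw [dπ_def, dπ_def, dπ_def, dπ_def, dπ_def]
  exact Eq.trans rfl h.symm

/-- The `𝔤`-action on the Harish-Chandra space `H_K^∞` by the differential of `π`, as a morphism of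
real Lie algebras `𝔤 → End_ℂ (H_K^∞)`. Harish-Chandra 1953, §7 (p. 209) and §9 (p. 225);
Wallach, Lemma 3.3.3 and §3.3.4. [folklore] -/
def harishChandraRepLie (hπ : π.IsStronglyContinuous) :
    G.lie →ₗ⁅ℝ⁆ Module.End ℂ (harishChandraSpace G π) where
  toFun X :=
    { toFun := fun v ↦ ⟨dπ G π v X, dπ_mem_harishChandraSpace G π hπ v.2 X⟩
      map_add' := fun v w ↦ Subtype.ext (dπ_add_left G π v.2.1 w.2.1 X)
      map_smul' := fun c v ↦ Subtype.ext (dπ_smul_left G π v.2.1 c X) }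
  map_add' X Y := by
    ext v
    exact dπ_add_right G π v X Y
  map_smul' t X := by
    ext v
    exact dπ_smul_right G π v t X
  map_lie' {X Y} := by
    ext v
    simp only [LinearMap.coe_mk, AddHom.coe_mk, Ring.lie_def, Module.End.mul_apply,
      LinearMap.sub_apply, Submodule.coe_sub]
    exact dπ_lie G π hπ v.2.1 X Y

/-- `harishChandraRepLie π hπ X v = dπ(X) v` in `H`. [folklore] -/
@[simp]
theorem coe_harishChandraRepLie_apply (hπ : π.IsStronglyContinuous) (X : G.lie)
    (v : harishChandraSpace G π) :
    (harishChandraRepLie G π hπ X v : H) = dπ G π v X := rfl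

/-- The differential action makes `H_K^∞` the Harish-Chandra module of `π`. [folklore] -/
theorem isHarishChandraModuleOf_harishChandraRepLie (hπ : π.IsStronglyContinuous) :
    IsHarishChandraModuleOf G π (harishChandraSpace G π) (harishChandraRepLie G π hπ) :=
  ⟨rfl, fun X v ↦ hasDerivAt_dπ G π (differentiableAt_of_mem_smoothVectors G π v.2.1) X⟩

end Smooth

/-- **Existence of the Harish-Chandra module** (discharge of `exists_isHarishChandraModuleOf`): for
a strongly continuous representation `π` of the linear real group `G` on a Banach space
(`dim 𝔤 < ∞`), the space `H_K^∞` of smooth `K`-finite vectors is stable under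
`X · v := d/dt π(exp tX) v |_{t=0}`, which is a real Lie algebra action. Here "smooth" is smoothness
of `Y ↦ π(exp Y) v` on `𝔤`; the proof is direct (Duhamel's formula for the differential of `exp`
transported to the representation, `C^k`-propagation from a neighbourhood of `0` to all of `𝔤`, and
symmetry of second derivatives for the bracket), so that no Lie-group structure on `G` is needed.
Harish-Chandra 1953, §7 (p. 209: `π(X)W ⊆ W`, `π(⁅X,Y⁆) = π(X)π(Y) − π(Y)π(X)`) and §9
(p. 225, differentiable vectors); Wallach, §1.6.2 (Lemma) and Lemma 3.3.3.
[cite: HarishChandra1953, §7 p. 209 and §9 p. 225] -/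
theorem exists_isHarishChandraModuleOf_holds : exists_isHarishChandraModuleOf G π := by
  intro _ _ hπ
  exact ⟨harishChandraRepLie G π hπ, isHarishChandraModuleOf_harishChandraRepLie G π hπ⟩

end HarishChandraModule

end Literature.NumberTheory.Automorphic
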